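import Summits.KontsevichZagierPeriods.KontsevichZagierPeriods.Theses.FermatIsogeny
import Summits.KontsevichZagierPeriods.KontsevichZagierPeriods.Theorems.FermatIsogenyBetaProductSectorStubProductValue
import Summits.KontsevichZagierPeriods.KontsevichZagierPeriods.Theorems.FermatIsogenyBetaProductSectorStubLinearFactor
import Summits.KontsevichZagierPeriods.KontsevichZagierPeriods.Theorems.FermatIsogenyBetaLinearSectorQuarters
import Summits.KontsevichZagierPeriods.KontsevichZagierPeriods.Theorems.TerasomaMultiplicationGammaHodgeFromRelatorsChains
import Summits.KontsevichZagierPeriods.KontsevichZagierPeriods.Theorems.FermatIsogenyBetaProductHodgeSectorOfGammaHodge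

/-!
# Crux `BetaProductSector` (stmt-KontsevichZagierPeriods-3898) — rung line `ProdRungFour`:
# Conjecture 1 for Beta PRODUCTS with QUARTER-INTEGER exponents (level 4, dimension 2)

Forward-harvest line (planner-fwd-harvest-KontsevichZagierPeriods-3898-0, 2026-08-17) filing the NEXT RUNG of the
level × dimension ladder of the crux (`Cruxes/BetaProductSector/Ladder.lean`, source seat
planner-fwd-ladder-KontsevichZagierPeriods-3898-0): `ProdRungFour := ProdRung 4` (verbatim copy of `Ladder.ProdRung`, below), i.e. the crux
`BetaProductSector` VERBATIM with the eight exponents restricted to `¼ℤ`.  FLOOR (dimension 1, landed, sorry-free):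
`Quarters.betaLinearSector_quarters` (= `Ladder.LinRung 4`, p156804).  The crux implies the rung
(`Ladder.prodRung_of_betaProductSector`); the rung does not give the crux back (probes in the source seat's `bc/probes.txt`).

THE LINE, in the formal period ring `P = FormalRep ⧸ relations` (`KZRulesAssociator`; `betaClass`, `kap`):
* the class of a representation pinned as `[(0,1)², c·x^{a-1}(1-x)^{b-1}y^{e-1}(1-y)^{d-1}]` is `κ(c)·β(a,b)·β(e,d)`
  (`LinearFactor.toFormalPeriod_pinned`, landed);
* GLUE 1 (proved here, `betaClass_eq_kap_mul_quarters`): by the FLOOR, every value identity `B(a,b) = q·B(a',b')`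
  between level-4 Beta values (`q` real algebraic) holds in `P`: `β(a,b) = κ(q)·β(a',b')`;
* STUB A (`stub_quarterAtomValues`, VALUES ONLY, no KZ content): every level-4 Beta value is a positive real-algebraic
  multiple of one of the four canonical atoms `W = (B(1,1), B(½,½), B(¼,½), B(¾,½)) = (1, π, L/√2, 4√2·π/L)`,
  `L = Γ(¼)²/√π` (Gamma recursion + the sixteen base cells; `Quarters.normalForm`, `stub_betaValuesQuarter`);
* GLUE 2 (proved here, `lemniscate_class`): EULER'S LEMNISCATE IDENTITY IN `P`,
  `β(¼,½)·β(¾,½) = 4·β(1,1)·β(½,½)` — the one two-dimensional coincidence of level 4 (`B(¼,½)B(¾,½) = 4π`), from the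
  landed Dirichlet re-association `betaClass_reassoc` at `(¼,½,½)`, the degenerate atom `β(¼,1) = κ(4)` and `β(1,1) = 1`;
* STUB C (`stub_quarterProductSeparation`, TRANSCENDENCE ONLY): the nine sorted products `W_i W_j` (`i ≤ j`) are pairwise
  NOT real-algebraic multiples of each other, except `W₂W₃ = 4·W₀W₁` — Chudnovsky (`π`, `Γ(¼)` algebraically independent,
  `algebraicIndependent_real_pi_gamma_one_quarter`; pattern `Quarters.vq_sep`, `Thirds.monomial_ne_algebraic_mul_monomial`);
* COMPOSITION (proved here, `prodRungFour_of_stubs`, `ProdRungFour_of`): both classes are `κ(·)·β(tᵢ)β(tⱼ)`; the value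
  identity and STUB C force either the same sorted pair (then the constants agree, `kap_congr`) or the lemniscate pair
  against the `π` pair (then GLUE 2); equal classes are equivalent representations (`KZ.toFormalPeriod_eq_iff`).

Stubs are stated over tree / Mathlib vocabulary only (no line-local definition), so that provers can land them by
name + signature with `--supports stmt-KontsevichZagierPeriods-3898`.
References: Kontsevich–Zagier 2001 §1.2; Andrews–Askey–Roy 1999 Thm 1.8.1, §1.5; Chudnovsky 1984 Ch. 7 §2 Cor. 2.3.
-/

set_option linter.dupNamespace false

noncomputable section

open MeasureTheory Set

namespace Summit.KontsevichZagierPeriods.KontsevichZagierPeriods.Cruxes.BetaProductSector.ProdRungFour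

open Literature.NumberTheory.Transcendental
open Literature.NumberTheory.Transcendental.KZ
open Summit.KontsevichZagierPeriods.GammaHodgeSectorKO
open Summit.KontsevichZagierPeriods.KontsevichZagierPeriods.BetaCancellationNegative (betaKernel)
open Summit.KontsevichZagierPeriods.FermatIsogeny.BetaProductSectorStubs (stub_productValue)
open Summit.KontsevichZagierPeriods.FermatIsogeny.BetaProductSectorStubs.LinearFactor (toFormalPeriod_pinned)
open Summit.KontsevichZagierPeriods.FermatIsogeny.BetaLinearSector.Quarters
  (betaLinearSector_quarters cast_quarter cast_half cast_threeQuarters)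
open Summit.KontsevichZagierPeriods.TerasomaMultiplication.GammaHodgeFromRelators (betaClass_one_one betaClass_reassoc)
open Summit.KontsevichZagierPeriods.FermatIsogeny.BetaProductHodgeSectorOfGammaHodge (betaClass_eq_kap_of_degenerate)

/-! ## The rung -/

/-- `ProdRung N` — VERBATIM COPY of `Summit.KontsevichZagierPeriods.KontsevichZagierPeriods.Cruxes.BetaProductSector.Ladder.ProdRung`
(`Cruxes/BetaProductSector/Ladder.lean`, commit 94826a4f5b05): the crux `BetaProductSector` with the eight exponents restricted to
`(1/N)ℤ`.  Inlined (not imported) so that this line elaborates independently of the farm build of the `Ladder` module, following the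
self-contained convention of this crux directory; the identification `ProdRungFour ↔ Ladder.ProdRung 4` is `Iff.rfl`
(`Lines/ProdRungFour_ladder.lean`).  Do not edit the text: it must stay syntactically identical to the ladder's. -/
def ProdRung (N : ℕ) : Prop :=
  ∀ (a b e d a' b' e' d' : ℚ) (q : ℝ), 0 < a → 0 < b → 0 < e → 0 < d → 0 < a' → 0 < b' → 0 < e' → 0 < d' →
    IsAlgebraic ℚ q →
    (∃ m : ℤ, a = m / N) → (∃ m : ℤ, b = m / N) → (∃ m : ℤ, e = m / N) → (∃ m : ℤ, d = m / N) →
    (∃ m : ℤ, a' = m / N) → (∃ m : ℤ, b' = m / N) → (∃ m : ℤ, e' = m / N) → (∃ m : ℤ, d' = m / N) →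
    ∀ (r r' : KZ.IntegralRep 2), r.domain = {x | ∀ i, x i ∈ Set.Ioo (0:ℝ) 1} →
    Set.EqOn r.integrand (fun x => (x 0) ^ ((a:ℝ) - 1) * (1 - x 0) ^ ((b:ℝ) - 1) * (x 1) ^ ((e:ℝ) - 1) *
      (1 - x 1) ^ ((d:ℝ) - 1)) r.domain →
    r'.domain = {x | ∀ i, x i ∈ Set.Ioo (0:ℝ) 1} →
    Set.EqOn r'.integrand (fun x => q * (x 0) ^ ((a':ℝ) - 1) * (1 - x 0) ^ ((b':ℝ) - 1) * (x 1) ^ ((e':ℝ) - 1) *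
      (1 - x 1) ^ ((d':ℝ) - 1)) r'.domain →
    r.value = r'.value → KZ.Equivalent r r'


/-- **The rung `ProdRung 4`**: `BetaProductSector` with all eight exponents in `¼ℤ` (the source ladder's `ProdRung`
at level `4`; closed form of `Ladder.ProdRung 4`). [cite: KontsevichZagier2001, §1.2] -/
def ProdRungFour : Prop := ProdRung 4

/-! ## The registered stubs -/

/-- **STUB A — level-4 atom values** (size M; special functions only): every Beta value with positive quarter-integer
exponents is a positive real-algebraic multiple of one of `B(1,1) = 1`, `B(½,½) = π`, `B(¼,½) = Γ(¼)²/√(2π)`,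
`B(¾,½) = 4π√(2π)/Γ(¼)²` (reduce to the sixteen base cells by `B(a,b+1) = b/(a+b)·B(a,b)`; base cells by Euler's
reflection / Legendre's duplication at `¼`, cf. `Quarters.normalForm`, `stub_betaValuesQuarter`).
[cite: AndrewsAskeyRoy1999, §1.5] -/
theorem stub_quarterAtomValues : ∀ (a b : ℚ), 0 < a → 0 < b → (∃ m : ℤ, a = m / 4) → (∃ m : ℤ, b = m / 4) → ∃ (i : Fin 4) (q : ℝ), IsAlgebraic ℚ q ∧ 0 < q ∧ ProbabilityTheory.beta (a:ℝ) b = q * ProbabilityTheory.beta ((![1, 1/2, 1/4, 3/4] : Fin 4 → ℝ) i) ((![1, 1/2, 1/2, 1/2] : Fin 4 → ℝ) i) := by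
  sorry

/-- **STUB C — separation of the level-4 product classes** (size M; transcendence only): among the sorted products
`W_i W_j` (`i ≤ j`) of the atoms `W = (B(1,1), B(½,½), B(¼,½), B(¾,½)) = (1, π, L/√2, 4√2π/L)`, `L = Γ(¼)²/√π`, a
real-algebraic proportionality forces the same pair, except for Euler's coincidence `W₂W₃ = 4π = 4·W₀W₁`: the ten
monomials `π^x Γ(¼)^y` have pairwise distinct exponents `(x,y)` apart from that one, and `π`, `Γ(¼)` are algebraically
independent (Chudnovsky; `algebraicIndependent_real_pi_gamma_one_quarter`, pattern `Quarters.vq_sep`).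
[cite: Chudnovsky1984, Ch. 7 §2 Cor. 2.3] -/
theorem stub_quarterProductSeparation : ∀ (i j i' j' : Fin 4) (k : ℝ), i ≤ j → i' ≤ j' → IsAlgebraic ℚ k → ProbabilityTheory.beta ((![1, 1/2, 1/4, 3/4] : Fin 4 → ℝ) i) ((![1, 1/2, 1/2, 1/2] : Fin 4 → ℝ) i) * ProbabilityTheory.beta ((![1, 1/2, 1/4, 3/4] : Fin 4 → ℝ) j) ((![1, 1/2, 1/2, 1/2] : Fin 4 → ℝ) j) = k * (ProbabilityTheory.beta ((![1, 1/2, 1/4, 3/4] : Fin 4 → ℝ) i') ((![1, 1/2, 1/2, 1/2] : Fin 4 → ℝ) i') * ProbabilityTheory.beta ((![1, 1/2, 1/4, 3/4] : Fin 4 → ℝ) j') ((![1, 1/2, 1/2, 1/2] : Fin 4 → ℝ) j')) → (i = i' ∧ j = j') ∨ (i = 2 ∧ j = 3 ∧ i' = 0 ∧ j' = 1) ∨ (i = 0 ∧ j = 1 ∧ i' = 2 ∧ j' = 3) := by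
  sorry

/-! ## Notation for the canonical atoms (proof-side only; the stubs above are literal) -/

/-- First exponents of the canonical atoms, rational. -/
local notation "tF" => (![1, 1/2, 1/4, 3/4] : Fin 4 → ℚ)
/-- Second exponents of the canonical atoms, rational. -/
local notation "tS" => (![1, 1/2, 1/2, 1/2] : Fin 4 → ℚ)
/-- First exponents of the canonical atoms, real. -/
local notation "tFℝ" => (![1, 1/2, 1/4, 3/4] : Fin 4 → ℝ)
/-- Second exponents of the canonical atoms, real. -/
local notation "tSℝ" => (![1, 1/2, 1/2, 1/2] : Fin 4 → ℝ)

/-- The atoms have positive rational exponents. [folklore] -/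
theorem atom_pos (i : Fin 4) : (0 : ℚ) < tF i ∧ (0 : ℚ) < tS i := by
  fin_cases i <;> norm_num

/-- The atoms are at level `4`. [folklore] -/
theorem atom_level (i : Fin 4) : (∃ m : ℤ, tF i = m / 4) ∧ (∃ m : ℤ, tS i = m / 4) := by
  fin_cases i
  · exact ⟨⟨4, by norm_num⟩, ⟨4, by norm_num⟩⟩
  · exact ⟨⟨2, by norm_num⟩, ⟨2, by norm_num⟩⟩
  · exact ⟨⟨1, by norm_num⟩, ⟨2, by norm_num⟩⟩
  · exact ⟨⟨3, by norm_num⟩, ⟨2, by norm_num⟩⟩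

/-- Rational and real exponent vectors agree. [folklore] -/
theorem atom_cast (i : Fin 4) : ((tF i : ℚ) : ℝ) = tFℝ i ∧ ((tS i : ℚ) : ℝ) = tSℝ i := by
  fin_cases i <;> norm_num

/-- The atom values are positive. [folklore] -/
theorem atom_value_pos (i : Fin 4) : 0 < ProbabilityTheory.beta (tFℝ i) (tSℝ i) := by
  apply ProbabilityTheory.beta_pos <;> fin_cases i <;> norm_num

/-! ## Glue 1: level-4 value identities hold in `P` (the floor `betaLinearSector_quarters`) -/

/-- **The floor, as identities of `P`**: if `B(a,b) = q·B(a',b')` with `q` real algebraic and `a, b, a', b'` positive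
quarter-integers, then `β(a,b) = κ(q)·β(a',b')` in `P` — one instance of `Quarters.betaLinearSector_quarters` on
`betaRep a b` and `q·betaRep a' b'`, then the constant factors out (`KZ.toFormalPeriod_of_constMul`).  (The proof is
`LinearFactor.betaClass_eq_kap_mul` with the open crux `BetaLinearSector` replaced by its landed level-4 case.)
[cite: KontsevichZagier2001, §1.2] -/
theorem betaClass_eq_kap_mul_quarters {a b a' b' : ℚ} {q : ℝ}
    (ha : 0 < a) (hb : 0 < b) (ha' : 0 < a') (hb' : 0 < b') (hq : IsAlgebraic ℚ q)
    (hma : ∃ m : ℤ, a = m / 4) (hmb : ∃ m : ℤ, b = m / 4) (hma' : ∃ m : ℤ, a' = m / 4) (hmb' : ∃ m : ℤ, b' = m / 4)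
    (hD : ProbabilityTheory.beta a b = q * ProbabilityTheory.beta a' b') :
    betaClass a b = kap q hq * betaClass a' b' := by
  set r : IntegralRep 1 := betaRep a b ha hb with hr
  set r' : IntegralRep 1 := (betaRep a' b' ha' hb').constMul q hq with hr'
  have hv : r.value = r'.value := by
    rw [hr, hr', IntegralRep.value_constMul, betaRep_value, betaRep_value, hD]
  have hEq : Equivalent r r' := by
    refine betaLinearSector_quarters a b a' b' q ha hb ha' hb' hq hma hmb hma' hmb' r r' rfl ?_ rfl ?_ hv
    · intro x _
      rw [hr, betaRep_integrand]
      rfl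
    · intro x _
      rw [hr', IntegralRep.integrand_constMul, betaRep_integrand]
      simp only [betaKernel]
      ring
  rw [betaClass_eq _ _ ha hb, hEq.toFormalPeriod_eq, hr', KZ.toFormalPeriod_of_constMul,
    ← betaClass_eq _ _ ha' hb']
  rfl

/-! ## Glue 2: Euler's lemniscate identity in `P` -/

/-- `B(¼,1) = 4`. [cite: AndrewsAskeyRoy1999, Thm 1.1.4] -/
theorem beta_quarter_one : ProbabilityTheory.beta (((1/4 : ℚ)) : ℝ) ((1 : ℚ) : ℝ) = ((4 : ℕ) : ℝ) := by
  rw [ProbabilityTheory.beta, cast_quarter]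
  push_cast
  rw [Real.Gamma_one, Real.Gamma_add_one (by norm_num : (1/4:ℝ) ≠ 0)]
  have hΓ : Real.Gamma (1/4 : ℝ) ≠ 0 := (Real.Gamma_pos_of_pos (by norm_num)).ne'
  field_simp

/-- **Euler's lemniscate identity in `P`**: `β(¼,½)·β(¾,½) = 4·β(1,1)·β(½,½)` — Dirichlet re-association at `(¼,½,½)`
(`betaClass_reassoc`: `β(¼,½)β(¾,½) = β(½,½)β(¼,1)`), the degenerate atom `β(¼,1) = κ(B(¼,1)) = κ(4) = 4`
(`betaClass_eq_kap_of_degenerate`, `kap_natCast`) and the unit `β(1,1) = 1`. On values: `B(¼,½)B(¾,½) = 4π`.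
[cite: AndrewsAskeyRoy1999, Thm 1.8.1] -/
theorem lemniscate_class :
    betaClass (1/4) (1/2) * betaClass (3/4) (1/2) = 4 * (betaClass 1 1 * betaClass (1/2) (1/2)) := by
  have h := betaClass_reassoc (1/4) (1/2) (1/2) (by norm_num) (by norm_num) (by norm_num)
  rw [show (1/4 + 1/2 : ℚ) = 3/4 by norm_num, show (1/2 + 1/2 : ℚ) = 1 by norm_num] at h
  obtain ⟨hc, e⟩ := betaClass_eq_kap_of_degenerate (1/4) 1 (by norm_num) (by norm_num) (Or.inr (by simp))
  have h4 : IsAlgebraic ℚ ((4 : ℕ) : ℝ) := by rw [← beta_quarter_one]; exact hc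
  rw [h, e, kap_congr hc h4 beta_quarter_one, kap_natCast 4 h4, betaClass_one_one, one_mul, Nat.cast_ofNat, mul_comm]

/-- The lemniscate identity on VALUES: `B(¼,½)·B(¾,½) = 4·(B(1,1)·B(½,½))` (apply `evalP`). [cite: AndrewsAskeyRoy1999, Thm 1.8.1] -/
theorem lemniscate_value :
    ProbabilityTheory.beta (1/4 : ℝ) (1/2) * ProbabilityTheory.beta (3/4 : ℝ) (1/2) =
      4 * (ProbabilityTheory.beta (1 : ℝ) 1 * ProbabilityTheory.beta (1/2 : ℝ) (1/2)) := by
  have h := congrArg evalP lemniscate_class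
  rw [map_mul, map_mul, map_mul, map_ofNat,
    evalP_betaClass _ _ (by norm_num) (by norm_num), evalP_betaClass _ _ (by norm_num) (by norm_num),
    evalP_betaClass _ _ (by norm_num) (by norm_num), evalP_betaClass _ _ (by norm_num) (by norm_num),
    cast_quarter, cast_half, cast_threeQuarters] at h
  simpa using h

/-! ## The composition -/

/-- CORE OF THE COMPOSITION (sorted pairs): if `Q·(W_i W_j) = Q'·(W_i' W_j')` with `Q, Q' > 0` real algebraic and
`i ≤ j`, `i' ≤ j'` (real algebraic `Q > 0`, `Q'`), then `κ(Q)·β(t_i)β(t_j) = κ(Q')·β(t_i')β(t_j')` in `P` — STUB C leaves the same pair (cancel the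
positive product, `kap_congr`) or the lemniscate pair against the `π` pair (GLUE 2 on classes and on values). [folklore] -/
theorem core
    (hC : ∀ (i j i' j' : Fin 4) (k : ℝ), i ≤ j → i' ≤ j' → IsAlgebraic ℚ k → ProbabilityTheory.beta ((![1, 1/2, 1/4, 3/4] : Fin 4 → ℝ) i) ((![1, 1/2, 1/2, 1/2] : Fin 4 → ℝ) i) * ProbabilityTheory.beta ((![1, 1/2, 1/4, 3/4] : Fin 4 → ℝ) j) ((![1, 1/2, 1/2, 1/2] : Fin 4 → ℝ) j) = k * (ProbabilityTheory.beta ((![1, 1/2, 1/4, 3/4] : Fin 4 → ℝ) i') ((![1, 1/2, 1/2, 1/2] : Fin 4 → ℝ) i') * ProbabilityTheory.beta ((![1, 1/2, 1/4, 3/4] : Fin 4 → ℝ) j') ((![1, 1/2, 1/2, 1/2] : Fin 4 → ℝ) j')) → (i = i' ∧ j = j') ∨ (i = 2 ∧ j = 3 ∧ i' = 0 ∧ j' = 1) ∨ (i = 0 ∧ j = 1 ∧ i' = 2 ∧ j' = 3))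
    {i j i' j' : Fin 4} (hij : i ≤ j) (hij' : i' ≤ j') {Q Q' : ℝ} (hQ : IsAlgebraic ℚ Q) (hQ' : IsAlgebraic ℚ Q')
    (hQ0 : 0 < Q)
    (h : Q * (ProbabilityTheory.beta (tFℝ i) (tSℝ i) * ProbabilityTheory.beta (tFℝ j) (tSℝ j)) =
      Q' * (ProbabilityTheory.beta (tFℝ i') (tSℝ i') * ProbabilityTheory.beta (tFℝ j') (tSℝ j'))) :
    kap Q hQ * (betaClass (tF i) (tS i) * betaClass (tF j) (tS j)) =
      kap Q' hQ' * (betaClass (tF i') (tS i') * betaClass (tF j') (tS j')) := by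
  have hW := atom_value_pos
  have hP : 0 < ProbabilityTheory.beta (tFℝ i) (tSℝ i) * ProbabilityTheory.beta (tFℝ j) (tSℝ j) :=
    mul_pos (hW i) (hW j)
  have hP' : 0 < ProbabilityTheory.beta (tFℝ i') (tSℝ i') * ProbabilityTheory.beta (tFℝ j') (tSℝ j') :=
    mul_pos (hW i') (hW j')
  have hk : IsAlgebraic ℚ (Q' * Q⁻¹) := hQ'.mul hQ.inv
  have key : ProbabilityTheory.beta (tFℝ i) (tSℝ i) * ProbabilityTheory.beta (tFℝ j) (tSℝ j) =
      Q' * Q⁻¹ * (ProbabilityTheory.beta (tFℝ i') (tSℝ i') * ProbabilityTheory.beta (tFℝ j') (tSℝ j')) := by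
    have hQne : Q ≠ 0 := hQ0.ne'
    field_simp
    linear_combination h
  have h4 : IsAlgebraic ℚ ((4 : ℕ) : ℝ) := by rw [← beta_quarter_one]; exact (betaClass_eq_kap_of_degenerate (1/4) 1 (by norm_num) (by norm_num) (Or.inr (by simp))).1
  rcases hC i j i' j' (Q' * Q⁻¹) hij hij' hk key with ⟨rfl, rfl⟩ | ⟨rfl, rfl, rfl, rfl⟩ | ⟨rfl, rfl, rfl, rfl⟩
  · -- the same sorted pair: the constants agree
    have hQQ : Q = Q' := mul_right_cancel₀ hP.ne' h
    rw [kap_congr hQ hQ' hQQ]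
  · -- the lemniscate pair `(2,3)` against the `π` pair `(0,1)`: `Q' = 4Q`
    have hv : ProbabilityTheory.beta (tFℝ 2) (tSℝ 2) * ProbabilityTheory.beta (tFℝ 3) (tSℝ 3) =
        4 * (ProbabilityTheory.beta (tFℝ 0) (tSℝ 0) * ProbabilityTheory.beta (tFℝ 1) (tSℝ 1)) := by
      simp only [Matrix.cons_val]
      exact lemniscate_value
    have hc : betaClass (tF 2) (tS 2) * betaClass (tF 3) (tS 3) = 4 * (betaClass (tF 0) (tS 0) * betaClass (tF 1) (tS 1)) := by
      simp only [Matrix.cons_val]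
      exact lemniscate_class
    have hQQ : Q * ((4 : ℕ) : ℝ) = Q' := by
      rw [hv, ← mul_assoc Q] at h
      exact_mod_cast mul_right_cancel₀ hP'.ne' h
    rw [hc, ← mul_assoc, ← kap_congr (hQ.mul h4) hQ' hQQ, kap_mul Q ((4 : ℕ) : ℝ) hQ h4, kap_natCast 4 h4, Nat.cast_ofNat]
  · -- the `π` pair `(0,1)` against the lemniscate pair `(2,3)`: `Q = 4Q'`
    have hv : ProbabilityTheory.beta (tFℝ 2) (tSℝ 2) * ProbabilityTheory.beta (tFℝ 3) (tSℝ 3) =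
        4 * (ProbabilityTheory.beta (tFℝ 0) (tSℝ 0) * ProbabilityTheory.beta (tFℝ 1) (tSℝ 1)) := by
      simp only [Matrix.cons_val]
      exact lemniscate_value
    have hc : betaClass (tF 2) (tS 2) * betaClass (tF 3) (tS 3) = 4 * (betaClass (tF 0) (tS 0) * betaClass (tF 1) (tS 1)) := by
      simp only [Matrix.cons_val]
      exact lemniscate_class
    have hQQ : Q' * ((4 : ℕ) : ℝ) = Q := by
      rw [hv, ← mul_assoc Q'] at h
      exact_mod_cast (mul_right_cancel₀ hP.ne' h).symm
    rw [hc, ← mul_assoc (kap Q' hQ'), ← kap_congr (hQ'.mul h4) hQ hQQ, kap_mul Q' ((4 : ℕ) : ℝ) hQ' h4, kap_natCast 4 h4, Nat.cast_ofNat]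

/-- **THE COMPOSITION**: STUB A → STUB C → the rung, UNFOLDED (`Ladder.ProdRung 4`), so that exactly one theorem of
this file, `ProdRungFour_of`, concludes the rung by name.  Classes by `toFormalPeriod_pinned`; the value identity by
`stub_productValue` (landed); the four atoms normalised by STUB A and GLUE 1; pairs sorted; `core`; equal classes are
equivalent representations (`KZ.toFormalPeriod_eq_iff`). [cite: KontsevichZagier2001, §1.2] -/
theorem prodRungFour_of_stubs
    (hA : ∀ (a b : ℚ), 0 < a → 0 < b → (∃ m : ℤ, a = m / 4) → (∃ m : ℤ, b = m / 4) → ∃ (i : Fin 4) (q : ℝ), IsAlgebraic ℚ q ∧ 0 < q ∧ ProbabilityTheory.beta (a:ℝ) b = q * ProbabilityTheory.beta ((![1, 1/2, 1/4, 3/4] : Fin 4 → ℝ) i) ((![1, 1/2, 1/2, 1/2] : Fin 4 → ℝ) i))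
    (hC : ∀ (i j i' j' : Fin 4) (k : ℝ), i ≤ j → i' ≤ j' → IsAlgebraic ℚ k → ProbabilityTheory.beta ((![1, 1/2, 1/4, 3/4] : Fin 4 → ℝ) i) ((![1, 1/2, 1/2, 1/2] : Fin 4 → ℝ) i) * ProbabilityTheory.beta ((![1, 1/2, 1/4, 3/4] : Fin 4 → ℝ) j) ((![1, 1/2, 1/2, 1/2] : Fin 4 → ℝ) j) = k * (ProbabilityTheory.beta ((![1, 1/2, 1/4, 3/4] : Fin 4 → ℝ) i') ((![1, 1/2, 1/2, 1/2] : Fin 4 → ℝ) i') * ProbabilityTheory.beta ((![1, 1/2, 1/4, 3/4] : Fin 4 → ℝ) j') ((![1, 1/2, 1/2, 1/2] : Fin 4 → ℝ) j')) → (i = i' ∧ j = j') ∨ (i = 2 ∧ j = 3 ∧ i' = 0 ∧ j' = 1) ∨ (i = 0 ∧ j = 1 ∧ i' = 2 ∧ j' = 3)) :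
    ProdRung 4 := by
  intro a b e d a' b' e' d' q ha hb he hd ha' hb' he' hd' hq hma hmb hme hmd hma' hmb' hme' hmd' r r' hrd hri hr'd hr'i hv
  -- (1) the classes of the two pinned product representations
  have hcr : toFormalPeriod (of r) = kap 1 isAlgebraic_one * (betaClass a b * betaClass e d) :=
    toFormalPeriod_pinned ha hb he hd 1 isAlgebraic_one r hrd (fun x hx => by simp only [hri hx, one_mul])
  have hcr' : toFormalPeriod (of r') = kap q hq * (betaClass a' b' * betaClass e' d') :=
    toFormalPeriod_pinned ha' hb' he' hd' q hq r' hr'd hr'i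
  -- (2) the Beta identity from the values
  have hβ : ProbabilityTheory.beta (a:ℝ) b * ProbabilityTheory.beta (e:ℝ) d =
      q * (ProbabilityTheory.beta (a':ℝ) b' * ProbabilityTheory.beta (e':ℝ) d') := by
    have h₁ := stub_productValue a b e d 1 ha hb he hd r hrd (fun x hx => by simp only [hri hx, one_mul])
    have h₂ := stub_productValue a' b' e' d' q ha' hb' he' hd' r' hr'd hr'i
    simp only [ProbabilityTheory.beta]
    rw [one_mul] at h₁
    rw [← h₁, ← h₂]
    exact hv
  -- (3) the four atoms in normal form, on values (STUB A) and in `P` (GLUE 1)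
  obtain ⟨i₁, q₁, hq₁, hq₁0, e₁⟩ := hA a b ha hb hma hmb
  obtain ⟨i₂, q₂, hq₂, hq₂0, e₂⟩ := hA e d he hd hme hmd
  obtain ⟨i₃, q₃, hq₃, hq₃0, e₃⟩ := hA a' b' ha' hb' hma' hmb'
  obtain ⟨i₄, q₄, hq₄, hq₄0, e₄⟩ := hA e' d' he' hd' hme' hmd'
  have cl : ∀ {x y : ℚ} {s : ℝ} (hx : 0 < x) (hy : 0 < y) (hs : IsAlgebraic ℚ s) (hmx : ∃ m : ℤ, x = m / 4)
      (hmy : ∃ m : ℤ, y = m / 4) (i : Fin 4),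
      ProbabilityTheory.beta (x:ℝ) y = s * ProbabilityTheory.beta (tFℝ i) (tSℝ i) →
      betaClass x y = kap s hs * betaClass (tF i) (tS i) := by
    intro x y s hx hy hs hmx hmy i hxy
    refine betaClass_eq_kap_mul_quarters hx hy (atom_pos i).1 (atom_pos i).2 hs hmx hmy (atom_level i).1
      (atom_level i).2 ?_
    rw [(atom_cast i).1, (atom_cast i).2]
    exact hxy
  have c₁ := cl ha hb hq₁ hma hmb i₁ e₁
  have c₂ := cl he hd hq₂ hme hmd i₂ e₂
  have c₃ := cl ha' hb' hq₃ hma' hmb' i₃ e₃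
  have c₄ := cl he' hd' hq₄ hme' hmd' i₄ e₄
  -- (4) both classes as `κ(·)·β(tᵢ)β(tⱼ)`, and the value identity in the same shape
  have hcl : toFormalPeriod (of r) =
      kap (q₁ * q₂) (hq₁.mul hq₂) * (betaClass (tF i₁) (tS i₁) * betaClass (tF i₂) (tS i₂)) := by
    rw [hcr, c₁, c₂, kap_one, one_mul, kap_mul q₁ q₂ hq₁ hq₂]
    ring
  have hcl' : toFormalPeriod (of r') =
      kap (q * q₃ * q₄) ((hq.mul hq₃).mul hq₄) * (betaClass (tF i₃) (tS i₃) * betaClass (tF i₄) (tS i₄)) := by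
    rw [hcr', c₃, c₄, kap_mul (q * q₃) q₄ (hq.mul hq₃) hq₄, kap_mul q q₃ hq hq₃]
    ring
  have hval : q₁ * q₂ * (ProbabilityTheory.beta (tFℝ i₁) (tSℝ i₁) * ProbabilityTheory.beta (tFℝ i₂) (tSℝ i₂)) =
      q * q₃ * q₄ * (ProbabilityTheory.beta (tFℝ i₃) (tSℝ i₃) * ProbabilityTheory.beta (tFℝ i₄) (tSℝ i₄)) := by
    rw [e₁, e₂, e₃, e₄] at hβ
    linear_combination hβ
  -- (5) equal classes are equivalent representations; sort the pairs and apply `core`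
  refine toFormalPeriod_eq_iff.mp ?_
  rw [hcl, hcl']
  have hQ0 : 0 < q₁ * q₂ := mul_pos hq₁0 hq₂0
  rcases le_total i₁ i₂ with h12 | h12 <;> rcases le_total i₃ i₄ with h34 | h34
  · exact core hC h12 h34 _ _ hQ0 hval
  · rw [mul_comm (betaClass (tF i₃) (tS i₃))]
    refine core hC h12 h34 _ _ hQ0 ?_
    rw [mul_comm (ProbabilityTheory.beta (tFℝ i₄) (tSℝ i₄))]
    exact hval
  · rw [mul_comm (betaClass (tF i₁) (tS i₁))]
    refine core hC h12 h34 _ _ hQ0 ?_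
    rw [mul_comm (ProbabilityTheory.beta (tFℝ i₂) (tSℝ i₂))]
    exact hval
  · rw [mul_comm (betaClass (tF i₁) (tS i₁)), mul_comm (betaClass (tF i₃) (tS i₃))]
    refine core hC h12 h34 _ _ hQ0 ?_
    rw [mul_comm (ProbabilityTheory.beta (tFℝ i₂) (tSℝ i₂)), mul_comm (ProbabilityTheory.beta (tFℝ i₄) (tSℝ i₄))]
    exact hval

/-- **THE RUNG FROM THE STUBS**: the one theorem of this file concluding `ProdRungFour` by name (skeleton theorem;
sorries only inside `stub_quarterAtomValues`, `stub_quarterProductSeparation`). [cite: KontsevichZagier2001, §1.2] -/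
theorem ProdRungFour_of : ProdRungFour :=
  prodRungFour_of_stubs stub_quarterAtomValues stub_quarterProductSeparation

end Summit.KontsevichZagierPeriods.KontsevichZagierPeriods.Cruxes.BetaProductSector.ProdRungFour

end
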